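/-
Copyright (c) 2026 the pub-hodgecm-mathlib formalisation cell (harness21).  Prover seat hodgecm-mathlib-F0P2-p06 (g11), 2026-09-01.  Road «S3-tree» (architect A-p16 (g30)),
brick T3′ «depth-zero κ-transfer», P-2 row (R2²) «THE FREE ROW, TYPE (2)» (holder A-p19 (g26)), head [T2-d] sub-organ (D2) «THE EIGEN-FIELD PACKAGE AT w» (dealt 20:05:53Z), part β:
the package over the ★ ramified quadratic dictionary [T2-L].
-/
import Literature.NumberTheory.NumberFields.RamifiedQuadraticDictionary      -- ★ p846635 [T2-L] (this seat): (L1) `exists_sqrt_and_coord_of_ramified`, (L2) `exists_involutions_of_ramified`, (L3) `exists_mul_map_eq_of_ramified`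
import HarnessLib

/-!
# T3′ P-2 row (R2²), organ (D2-β) «THE EIGEN-FIELD PACKAGE AT w»: `θ = √d`, the isometric involutions `s̃ ∕ ι′` of `K = F_v(θ)`, the eigenvalue `λ₁ = (t + yθ)∕2`, and the three
# norm dictionaries (rE)(nK)(nE) of ★ `RationalGoodVectorParity.exists_rational_good_iff_even`

Topic `NumberTheory/Rogawski1990`; namespace `Literature.NumberTheory.Rogawski1990`.  THEOREMS ONLY (no definition, no instance, no notation, no named fact, no `sorry`); kernel lane
`--supports stmt-HodgeConjecture-24833`.  Cell `pub/hodgecm-mathlib` (D-0151), crux H413; road «S3-tree», brick T3′, P-2 row (R2²) «THE FREE ROW, TYPE (2)» (holder A-p19 (g26), head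
[T2-d] `ncard_rankStrata_two_sub_eq_neg_one_pow_mul`; architect A-p16 (g30) A-145), sub-organ **(D2) «THE EIGEN-FIELD PACKAGE AT w»** (A-p19 20:05:53Z), part β = the GENERIC package
in the frame of ★ [T2-L] `RamifiedQuadraticDictionary` (quadratic number fields `F ⊂ E`, `δ² = m`, `σ δ = −δ`, a finite place `v`, a UNIFORMISER `d ∈ F_v` with `d⁻¹ m ∈ □`, `w ∣ v`,
`K := E_w = F_v(√d)`, `ι₁ := toPlace v w`) PLUS an isometric involution `s` of `F_v` fixing `d` (CM conjugation in the application, part α `InertPlaceSkewDiscriminantRoot`) and the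
type-(2) eigen-data `u t D y e₂ ∈ F_v` of a deep match (★ (D1) A-p12 (g22)).  HONEST LABEL: HC_CM is proved only modulo the 2 remaining named inputs (hLiu418 24832, h413 24833)
until rung 0 closes; unconditional local algebra, count-neutral.

THE PACKAGE (`exists_eigenField_package`, ONE `obtain ⟨θ, s', ι', …⟩` for (D3)∕(D4) and for B-p14 (g37)'s frame half (D2-γ)):
* `θ` — (L1): `θ² = ι₁ d`, `|θ| = exp(−1)`, unique coordinates `z = ι₁ p + ι₁ q θ`, `ι₁ p + ι₁ q θ ∈ 𝒪 ↔ p, q ∈ 𝒪`;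
* `s̃` — (L2) + isometry: `s̃ ∘ ι₁ = ι₁ ∘ s`, `s̃ θ = θ`, `s̃ s̃ = id`, `s̃ 𝒪 ⊆ 𝒪`, `|s̃ z| = |z|`;  `ι′` — `ι′ ∘ ι₁ = ι₁`, `ι′ θ = −θ`, `ι′ ι′ = id`, `ι′ 𝒪 ⊆ 𝒪`, `|ι′ z| = |z|`;  `s̃ ∘ ι′ = ι′ ∘ s̃`;
* `λ₁ := (ι₁ t + ι₁ y · θ) · ι₁ e₂` (an explicit TERM, no definition): `λ₁² − ι₁ t · λ₁ + ι₁ D = 0`, `λ₁ ∈ 𝒪`, `|λ₁ − 1| < 1`, `λ₁ · s̃ λ₁ = 1`, `ι′ λ₁ = (ι₁ t − ι₁ y · θ) · ι₁ e₂`,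
  `ι′ λ₁ ≠ λ₁`, `|ι₁ u − λ₁| = exp(−n)`, `|λ₁ − ι′ λ₁| = exp(−(2N+1))` (`K`-units; `|χ_g(u)|_v = exp(−n)`, `|y|_v = exp(−N)`);
* the dictionaries of ★ B-p14 `exists_rational_good_iff_even` in its binder spelling: (rE) `ι′ x = x ⇒ Even (log|x|)`, (nK) `s̃ c = c ⇒ Even (log|c|) ⇒ ∃ a, a·s̃ a·c = 1` (★ (L3):
  `K ∕ K^{s̃}` unramified), (nE) `s̃ c = c ⇒ ι′ c = c ⇒ 4 ∣ log|c| ⇒ ∃ a, ι′ a = a ∧ a·s̃ a·c = 1` (the hypothesis `hnormF` on `(F_v, s)`).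

## References
* [Rogawski1990] J. D. Rogawski, *Automorphic Representations of Unitary Groups in Three Variables* (1990): §4.9 Lemma 4.9.3 p. 56, Prop. 4.9.1 (b) p. 55.
* [SerreLocalFields1979] J.-P. Serre, *Local Fields*, GTM 67 (1979): Ch. I §6 Prop. 17–18; Ch. V §2 Prop. 3 and Corollary.
* [Jacobowitz1962] R. Jacobowitz, *Hermitian forms over local fields*, Amer. J. Math. 84 (1962): §5, §7.
* [Neukirch1999] J. Neukirch, *Algebraic Number Theory*, Grundlehren 322 (1999): Ch. II (8.2)–(8.3).
-/

set_option autoImplicit false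

noncomputable section

open NumberField IsDedekindDomain Polynomial
open scoped ValuativeRel
open Literature.NumberTheory.Automorphic Literature.NumberTheory.Automorphic.UnitaryGroup Literature.NumberTheory.NumberFields

namespace Literature.NumberTheory.Rogawski1990

variable {F : Type} (E : Type) [Field F] [NumberField F] [Field E] [NumberField E] [Algebra F E] [Algebra.IsQuadraticExtension F E]
  (v : HeightOneSpectrum (𝓞 F)) (σ : E ≃ₐ[F] E) {δ : E} (hσδ : σ δ = -δ) (hδ : δ ≠ 0) {m : F} (hm : algebraMap F E m = δ ^ 2)
  {d : v.adicCompletion F} (hd : Valued.v d = WithZero.exp (-1 : ℤ)) (hdm : IsSquare (d⁻¹ * (m : v.adicCompletion F)))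
  (w : PlacesOver E v)
  -- the isometric involution `s` of `F_v` fixing `d` (CM conjugation `σ_w` of `L_w` in the application), moving an integer by a unit, with the even-order norm dictionary
  (s : v.adicCompletion F →+* v.adicCompletion F) (hss : ∀ x, s (s x) = x) (hsd : s d = d) (hsv : ∀ x, Valued.v (s x) = Valued.v x)
  (hmove : ∃ a : 𝒪[v.adicCompletion F], IsUnit a ∧ s a - a ∈ 𝒪[v.adicCompletion F] ∧ ∃ b : 𝒪[v.adicCompletion F], (b : v.adicCompletion F) * (s a - a) = 1)
  (hnormF : ∀ c : v.adicCompletion F, c ≠ 0 → s c = c → Even (WithZero.log (Valued.v c)) → ∃ a : v.adicCompletion F, a * s a * c = 1)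
  -- the type-(2) eigen-data of a deep match (★ (D1)): `χ_g = X² − tX + D`, `disc χ_g = y² d`, the norm-one eigenvalue `u`, `e₂ = 1∕2`
  (u t D y e₂ : v.adicCompletion F) (h2e : e₂ * 2 = 1) (h2 : Valued.v (2 : v.adicCompletion F) = 1) (hD : 4 * D = t * t - y * y * d)
  (hσD : D * s D = 1) (hσt : s t = t * s D) (hσy : s y = -(y * s D))
  {n N : ℕ} (hn : Valued.v (u * u - t * u + D) = WithZero.exp (-(n : ℤ))) (hN : Valued.v y = WithZero.exp (-(N : ℤ)))
  (ht2 : Valued.v (t - 2) < 1)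

include hσδ hδ hm hd hdm hss hsd hsv hmove hnormF h2e h2 hD hσD hσt hσy hn hN ht2 in
/-- **(D2-β) THE EIGEN-FIELD PACKAGE AT `w`** (see the module docstring for the list of conjuncts and their sources).
[cite: Rogawski1990, §4.9 Lemma 4.9.3 p. 56] [cite: SerreLocalFields1979, Ch. I §6 Prop. 17–18; Ch. V §2 Prop. 3] [cite: Jacobowitz1962, §5] -/
theorem exists_eigenField_package :
    ∃ (θ : w.1.adicCompletion E) (s' ι' : w.1.adicCompletion E →+* w.1.adicCompletion E),
      -- (L1) `θ = √d` and the Eisenstein coordinates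
      (θ ^ 2 = toPlace v w d ∧ Valued.v θ = WithZero.exp (-1 : ℤ) ∧
        (∀ z : w.1.adicCompletion E, ∃! pq : v.adicCompletion F × v.adicCompletion F, z = toPlace v w pq.1 + toPlace v w pq.2 * θ) ∧
        (∀ p q : v.adicCompletion F, toPlace v w p + toPlace v w q * θ ∈ 𝒪[w.1.adicCompletion E] ↔ p ∈ 𝒪[v.adicCompletion F] ∧ q ∈ 𝒪[v.adicCompletion F])) ∧
      -- (L2) the involution `s̃` over `s` fixing `θ`, isometric
      ((∀ x, s' (toPlace v w x) = toPlace v w (s x)) ∧ s' θ = θ ∧ (∀ z, s' (s' z) = z) ∧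
        (∀ z : 𝒪[w.1.adicCompletion E], s' z ∈ 𝒪[w.1.adicCompletion E]) ∧ (∀ z, Valued.v (s' z) = Valued.v z)) ∧
      -- (L2) the `F_v`-linear involution `ι′` with `ι′ θ = −θ`, isometric, commuting with `s̃`
      ((∀ x, ι' (toPlace v w x) = toPlace v w x) ∧ ι' θ = -θ ∧ (∀ z, ι' (ι' z) = z) ∧
        (∀ z : 𝒪[w.1.adicCompletion E], ι' z ∈ 𝒪[w.1.adicCompletion E]) ∧ (∀ z, Valued.v (ι' z) = Valued.v z) ∧ (∀ z, s' (ι' z) = ι' (s' z))) ∧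
      -- the eigenvalue `λ₁ := (ι₁ t + ι₁ y · θ) · ι₁ e₂`
      (((toPlace v w t + toPlace v w y * θ) * toPlace v w e₂) ^ 2 - toPlace v w t * ((toPlace v w t + toPlace v w y * θ) * toPlace v w e₂) + toPlace v w D = 0 ∧
        (toPlace v w t + toPlace v w y * θ) * toPlace v w e₂ ∈ 𝒪[w.1.adicCompletion E] ∧
        Valued.v ((toPlace v w t + toPlace v w y * θ) * toPlace v w e₂ - 1) < 1 ∧
        (toPlace v w t + toPlace v w y * θ) * toPlace v w e₂ * s' ((toPlace v w t + toPlace v w y * θ) * toPlace v w e₂) = 1 ∧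
        ι' ((toPlace v w t + toPlace v w y * θ) * toPlace v w e₂) = (toPlace v w t - toPlace v w y * θ) * toPlace v w e₂ ∧
        ι' ((toPlace v w t + toPlace v w y * θ) * toPlace v w e₂) ≠ (toPlace v w t + toPlace v w y * θ) * toPlace v w e₂ ∧
        Valued.v (toPlace v w u - (toPlace v w t + toPlace v w y * θ) * toPlace v w e₂) = WithZero.exp (-(n : ℤ)) ∧
        Valued.v ((toPlace v w t + toPlace v w y * θ) * toPlace v w e₂ - ι' ((toPlace v w t + toPlace v w y * θ) * toPlace v w e₂)) =
          WithZero.exp (-((2 * N + 1 : ℕ) : ℤ))) ∧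
      -- the three norm dictionaries (rE) (nK) (nE) of ★ `exists_rational_good_iff_even`, in its binder spelling
      ((∀ x : w.1.adicCompletion E, x ≠ 0 → ι' x = x → Even (WithZero.log (Valued.v x))) ∧
        (∀ c : w.1.adicCompletion E, c ≠ 0 → s' c = c → Even (WithZero.log (Valued.v c)) → ∃ a : w.1.adicCompletion E, a * s' a * c = 1) ∧
        (∀ c : w.1.adicCompletion E, c ≠ 0 → s' c = c → ι' c = c → (4 : ℤ) ∣ WithZero.log (Valued.v c) →
          ∃ a : w.1.adicCompletion E, ι' a = a ∧ a * s' a * c = 1)) := by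
  have hι : Function.Injective (toPlace v w) := (toPlace v w).injective
  have h20 : (2 : v.adicCompletion F) ≠ 0 := fun h0 => by rw [h0, map_zero] at h2; exact zero_ne_one h2
  -- `s 𝒪 ⊆ 𝒪` from the isometry
  have hsO : ∀ x : 𝒪[v.adicCompletion F], s x ∈ 𝒪[v.adicCompletion F] := fun x => by
    rw [mem_integer_iff_valued_le_one, hsv]; exact (mem_integer_iff_valued_le_one _).1 x.2
  have he : v.asIdeal.ramificationIdx' w.1.asIdeal = 2 := ramificationIdx'_eq_two_of_uniformizer E v σ hσδ hδ hm hd hdm w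
  -- ★ [T2-L] (L1) and (L2)
  obtain ⟨θ, hθ, hθv, hcoord, hint⟩ := exists_sqrt_and_coord_of_ramified E v σ hσδ hδ hm hd hdm w
  obtain ⟨⟨s', hs'ι, hs'θ, hs's', hs'O⟩, ⟨ι', hι'ι, hι'θ, hι'ι', hι'O⟩⟩ :=
    exists_involutions_of_ramified E v σ hσδ hδ hm hd hdm w s hss hsd hsO hθ
  -- valuations in the Eisenstein coordinates
  have hιv : ∀ p : v.adicCompletion F, Valued.v (toPlace v w p) = Valued.v p ^ 2 := valued_toPlace_of_ramificationIdx'_eq_two E v w he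
  have hval : ∀ p q : v.adicCompletion F, Valued.v (toPlace v w p + toPlace v w q * θ) = max (Valued.v p ^ 2) (Valued.v q ^ 2 * WithZero.exp (-1 : ℤ)) :=
    valued_toPlace_add_toPlace_mul_of_ramified E v w he hθv
  have hco : ∀ z : w.1.adicCompletion E, ∃ pq : v.adicCompletion F × v.adicCompletion F, z = toPlace v w pq.1 + toPlace v w pq.2 * θ :=
    fun z => (hcoord z).exists
  have hs'pq : ∀ p q : v.adicCompletion F, s' (toPlace v w p + toPlace v w q * θ) = toPlace v w (s p) + toPlace v w (s q) * θ := fun p q => by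
    rw [map_add, map_mul, hs'ι, hs'ι, hs'θ]
  have hι'pq : ∀ p q : v.adicCompletion F, ι' (toPlace v w p + toPlace v w q * θ) = toPlace v w p + toPlace v w (-q) * θ := fun p q => by
    rw [map_add, map_mul, hι'ι, hι'ι, hι'θ, map_neg]; ring
  -- isometries and the commutation
  have hs'v : ∀ z, Valued.v (s' z) = Valued.v z := fun z => by
    obtain ⟨pq, rfl⟩ := hco z
    rw [hs'pq, hval, hval, hsv, hsv]
  have hι'v : ∀ z, Valued.v (ι' z) = Valued.v z := fun z => by
    obtain ⟨pq, rfl⟩ := hco z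
    rw [hι'pq, hval, hval, Valuation.map_neg]
  have hcomm : ∀ z, s' (ι' z) = ι' (s' z) := fun z => by
    obtain ⟨pq, rfl⟩ := hco z
    rw [hι'pq, hs'pq, hs'pq, hι'pq, map_neg]
  -- `ι′`-fixed elements are `ι₁ p`
  have hθ0 : θ ≠ 0 := fun h0 => by rw [h0, map_zero] at hθv; exact WithZero.coe_ne_zero hθv.symm
  have hfix : ∀ x : w.1.adicCompletion E, ι' x = x → ∃ p : v.adicCompletion F, x = toPlace v w p := by
    intro x hx
    obtain ⟨pq, rfl⟩ := hco x
    rw [hι'pq] at hx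
    have huniq := (hcoord (toPlace v w pq.1 + toPlace v w pq.2 * θ)).unique (y₁ := (pq.1, -pq.2)) (y₂ := (pq.1, pq.2)) hx.symm rfl
    have hq : pq.2 = 0 := by
      have h1 : -pq.2 = pq.2 := congrArg Prod.snd huniq
      have h2' : (2 : v.adicCompletion F) * pq.2 = 0 := by linear_combination -h1
      exact (mul_eq_zero.1 h2').resolve_left h20
    exact ⟨pq.1, by rw [hq, map_zero, zero_mul, add_zero]⟩
  -- the scalars `e = ι₁ e₂`, `T`, `Y`, `ι₁ D`
  have h2e' : toPlace v w e₂ * 2 = 1 := by rw [← map_ofNat (toPlace v w) 2, ← map_mul, h2e, map_one]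
  have hD' : 4 * toPlace v w D = toPlace v w t * toPlace v w t - toPlace v w y * toPlace v w y * toPlace v w d := by
    rw [← map_ofNat (toPlace v w) 4, ← map_mul, hD, map_sub, map_mul, map_mul, map_mul]
  have hve₂ : Valued.v e₂ = 1 := by
    have h := congrArg Valued.v h2e
    rw [map_mul, h2, mul_one, map_one] at h
    exact h
  have hse₂ : s e₂ = e₂ := by
    have h1 : s e₂ * 2 = 1 := by
      have := congrArg s h2e
      rwa [map_mul, map_ofNat, map_one] at this
    have h3 : s e₂ * 2 = e₂ * 2 := by rw [h1, h2e]
    exact mul_right_cancel₀ h20 h3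
  have hvt : Valued.v t = 1 := by
    have h := Valued.v.map_add_eq_of_lt_left (x := (2 : v.adicCompletion F)) (y := t - 2) (by rw [h2]; exact ht2)
    rw [add_sub_cancel, h2] at h
    exact h
  have hy0 : y ≠ 0 := fun h0 => by rw [h0, map_zero] at hN; exact WithZero.coe_ne_zero hN.symm
  -- the eigenvalue `λ₁ = (T + Yθ)e` and its conjugate
  have hlam_coord : (toPlace v w t + toPlace v w y * θ) * toPlace v w e₂ = toPlace v w (e₂ * t) + toPlace v w (e₂ * y) * θ := by
    rw [map_mul, map_mul]; ring
  have hι'lam : ι' ((toPlace v w t + toPlace v w y * θ) * toPlace v w e₂) = (toPlace v w t - toPlace v w y * θ) * toPlace v w e₂ := by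
    rw [map_mul, map_add, map_mul, hι'ι, hι'ι, hι'ι, hι'θ]; ring
  have hs'lam : s' ((toPlace v w t + toPlace v w y * θ) * toPlace v w e₂) =
      toPlace v w (s D) * ((toPlace v w t - toPlace v w y * θ) * toPlace v w e₂) := by
    rw [map_mul, map_add, map_mul, hs'ι, hs'ι, hs'ι, hs'θ, hσt, hσy, hse₂, map_mul, map_neg, map_mul]; ring
  have hdiff : (toPlace v w t + toPlace v w y * θ) * toPlace v w e₂ - (toPlace v w t - toPlace v w y * θ) * toPlace v w e₂ = toPlace v w y * θ := by
    linear_combination (toPlace v w y * θ) * h2e'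
  -- the elementary symmetric functions of `λ₁ = (T + Yθ)e` and `λ₂ = (T − Yθ)e`
  have hsum : (toPlace v w t + toPlace v w y * θ) * toPlace v w e₂ + (toPlace v w t - toPlace v w y * θ) * toPlace v w e₂ = toPlace v w t := by
    linear_combination (toPlace v w t) * h2e'
  have hprd : (toPlace v w t + toPlace v w y * θ) * toPlace v w e₂ * ((toPlace v w t - toPlace v w y * θ) * toPlace v w e₂) = toPlace v w D := by
    linear_combination (-(toPlace v w e₂ ^ 2 * toPlace v w y ^ 2)) * hθ + (-(toPlace v w e₂ ^ 2)) * hD' +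
      (toPlace v w D * (2 * toPlace v w e₂ + 1)) * h2e'
  have hquad : ((toPlace v w t + toPlace v w y * θ) * toPlace v w e₂) ^ 2 - toPlace v w t * ((toPlace v w t + toPlace v w y * θ) * toPlace v w e₂) +
      toPlace v w D = 0 := by
    linear_combination ((toPlace v w t + toPlace v w y * θ) * toPlace v w e₂) * hsum - hprd
  have hprod : (toPlace v w u - (toPlace v w t + toPlace v w y * θ) * toPlace v w e₂) * (toPlace v w u - (toPlace v w t - toPlace v w y * θ) * toPlace v w e₂) =
      toPlace v w (u * u - t * u + D) := by
    rw [map_add, map_sub, map_mul, map_mul]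
    linear_combination (-(toPlace v w u)) * hsum + hprd
  have hnorm1 : (toPlace v w t + toPlace v w y * θ) * toPlace v w e₂ * s' ((toPlace v w t + toPlace v w y * θ) * toPlace v w e₂) = 1 := by
    have hσD' : toPlace v w D * toPlace v w (s D) = 1 := by rw [← map_mul, hσD, map_one]
    rw [hs'lam]
    linear_combination (toPlace v w (s D)) * hprd + hσD'
  refine ⟨θ, s', ι', ⟨hθ, hθv, hcoord, hint⟩, ⟨hs'ι, hs'θ, hs's', hs'O, hs'v⟩, ⟨hι'ι, hι'θ, hι'ι', hι'O, hι'v, hcomm⟩,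
    ⟨hquad, ?_, ?_, hnorm1, hι'lam, ?_, ?_, ?_⟩, ⟨?_, ?_, ?_⟩⟩
  · -- `λ₁ ∈ 𝒪`
    rw [hlam_coord, hint, mem_integer_iff_valued_le_one, mem_integer_iff_valued_le_one, map_mul, map_mul, hve₂, hvt, hN, one_mul, one_mul]
    exact ⟨le_rfl, by rw [← WithZero.exp_zero, WithZero.exp_le_exp]; omega⟩
  · -- `|λ₁ − 1| < 1`
    have h1 : (toPlace v w t + toPlace v w y * θ) * toPlace v w e₂ - 1 = toPlace v w (e₂ * (t - 2)) + toPlace v w (e₂ * y) * θ := by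
      rw [map_mul, map_mul, map_sub, map_ofNat]
      linear_combination h2e'
    rw [h1, hval, max_lt_iff, map_mul, map_mul, hve₂, one_mul, one_mul]
    refine ⟨pow_lt_one₀ zero_le ht2 two_ne_zero, ?_⟩
    rw [hN, ← WithZero.exp_nsmul, ← WithZero.exp_add, ← WithZero.exp_zero, WithZero.exp_lt_exp, nsmul_eq_mul]
    push_cast
    omega
  · -- `ι′ λ₁ ≠ λ₁`
    rw [hι'lam]
    intro h
    have h0 : toPlace v w y * θ = 0 := by rw [← hdiff, h, sub_self]
    rcases mul_eq_zero.1 h0 with h1 | h1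
    · exact hy0 ((map_eq_zero_iff _ hι).1 h1)
    · exact hθ0 h1
  · -- `|ι₁ u − λ₁| = exp(−n)`
    have hsq : Valued.v (toPlace v w u - (toPlace v w t + toPlace v w y * θ) * toPlace v w e₂) ^ 2 = WithZero.exp (-(n : ℤ)) ^ 2 := by
      have hconj : ι' (toPlace v w u - (toPlace v w t + toPlace v w y * θ) * toPlace v w e₂) = toPlace v w u - (toPlace v w t - toPlace v w y * θ) * toPlace v w e₂ := by
        rw [map_sub, hι'ι, hι'lam]
      rw [sq, ← WithZero.exp_nsmul]
      nth_rw 2 [← hι'v]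
      rw [hconj, ← map_mul, hprod, hιv, hn, ← WithZero.exp_nsmul]
    have h0 : Valued.v (toPlace v w u - (toPlace v w t + toPlace v w y * θ) * toPlace v w e₂) ≠ 0 := by
      intro h0; rw [h0, zero_pow two_ne_zero, eq_comm] at hsq; exact (pow_ne_zero 2 WithZero.exp_ne_zero) hsq
    have hx := WithZero.exp_log h0
    rw [← hx, ← WithZero.exp_nsmul, ← WithZero.exp_nsmul, WithZero.exp_inj, nsmul_eq_mul, nsmul_eq_mul] at hsq
    rw [← hx]
    congr 1
    push_cast at hsq
    omega
  · -- `|λ₁ − ι′λ₁| = exp(−(2N+1))`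
    rw [hι'lam, hdiff, map_mul, hιv, hN, hθv, ← WithZero.exp_nsmul, ← WithZero.exp_add, nsmul_eq_mul]
    congr 1; push_cast; ring
  · -- (rE)
    intro x hx0 hx
    obtain ⟨p, rfl⟩ := hfix x hx
    have hp0 : Valued.v p ≠ 0 := fun h0 => hx0 (by rw [(Valuation.zero_iff _).1 h0, map_zero])
    rw [hιv, sq, WithZero.log_mul hp0 hp0]
    exact ⟨_, rfl⟩
  · -- (nK): `s̃`-fixed elements of even order are norms from `K` (★ (L3))
    intro c hc0 hsc ⟨k, hk⟩
    have hvc0 : Valued.v c ≠ 0 := (Valuation.ne_zero_iff _).2 hc0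
    -- `u₀ := c · θ^{2k}` is an `s̃`-fixed unit
    have hu₀v : Valued.v (c * θ ^ (k + k)) = 1 := by
      rw [map_mul, map_zpow₀, hθv, ← WithZero.exp_zsmul, ← WithZero.exp_log hvc0, hk, ← WithZero.exp_add, ← WithZero.exp_zero]
      congr 1; simp only [smul_eq_mul]; ring
    have hu₀O : c * θ ^ (k + k) ∈ 𝒪[w.1.adicCompletion E] := (mem_integer_iff_valued_le_one _).2 hu₀v.le
    have hu₀ne : c * θ ^ (k + k) ≠ 0 := mul_ne_zero hc0 (zpow_ne_zero _ hθ0)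
    have hu₀u : IsUnit (⟨c * θ ^ (k + k), hu₀O⟩ : 𝒪[w.1.adicCompletion E]) := by
      have hinvO : (c * θ ^ (k + k))⁻¹ ∈ 𝒪[w.1.adicCompletion E] := (mem_integer_iff_valued_le_one _).2 (by rw [map_inv₀, hu₀v, inv_one])
      exact IsUnit.of_mul_eq_one ⟨_, hinvO⟩ (Subtype.ext (mul_inv_cancel₀ hu₀ne))
    have hsu₀ : s' ((⟨c * θ ^ (k + k), hu₀O⟩ : 𝒪[w.1.adicCompletion E]) : w.1.adicCompletion E) = c * θ ^ (k + k) := by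
      change s' (c * θ ^ (k + k)) = _
      rw [map_mul, map_zpow₀, hsc, hs'θ]
    obtain ⟨t₀, ht₀⟩ := exists_mul_map_eq_of_ramified E v w s hmove s' hs'ι hs's' hs'O _ hu₀u hsu₀
    have ht₀' : (t₀ : w.1.adicCompletion E) * s' t₀ = c * θ ^ (k + k) := ht₀
    have ht₀0 : (t₀ : w.1.adicCompletion E) ≠ 0 := by
      intro h0
      rw [h0, zero_mul] at ht₀'
      exact hu₀ne ht₀'.symm
    have hs't₀0 : s' (t₀ : w.1.adicCompletion E) ≠ 0 := (map_ne_zero s').2 ht₀0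
    refine ⟨θ ^ k * (t₀ : w.1.adicCompletion E)⁻¹, ?_⟩
    rw [map_mul, map_inv₀, map_zpow₀, hs'θ]
    field_simp
    rw [ht₀', zpow_add₀ hθ0]
    ring
  · -- (nE): doubly fixed elements with `4 ∣ log` are norms of `ι′`-fixed elements (`hnormF`)
    intro c hc0 hsc hιc h4
    obtain ⟨p, rfl⟩ := hfix c hιc
    have hp0 : p ≠ 0 := fun h0 => hc0 (by rw [h0, map_zero])
    have hvp0 : Valued.v p ≠ 0 := (Valuation.ne_zero_iff _).2 hp0
    have hsp : s p = p := hι (by rw [← hs'ι, hsc])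
    have heven : Even (WithZero.log (Valued.v p)) := by
      rw [hιv, sq, WithZero.log_mul hvp0 hvp0] at h4
      obtain ⟨r, hr⟩ := h4
      exact ⟨r, by omega⟩
    obtain ⟨a₀, ha₀⟩ := hnormF p hp0 hsp heven
    exact ⟨toPlace v w a₀, hι'ι a₀, by rw [hs'ι, ← map_mul, ← map_mul, ha₀, map_one]⟩

end Literature.NumberTheory.Rogawski1990

end
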